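import Literature.MathematicalPhysics.QuantumFieldTheory.Balaban1983to89.B11Eq26ActionExpansion
import Literature.MathematicalPhysics.QuantumFieldTheory.Balaban1983to89.B9Eq369Product

/-!
# `Balaban1983to89.B11Eq26FirstVariation` — T. Bałaban, *The variational problem and background fields in renormalization group method for lattice gauge theories*, Commun. Math. Phys. **102** (1985) 277–309 [Balaban1985Variational]: (26)–(28) p. 282, the FIRST-ORDER STRUCTURE of the expansion (26) at `A = 0`

statement-level skeleton of published theorems with citation tags; proofs where landed; nothing here is a claim about the Yang–Mills mass gap

PDF held: `paper:balaban1985-cmp102-variational-background` (journal page = PDF page + 276); p. 282 [PDF 6] re-read by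
this seat (lit-balaban reader/typer r08, gen 11, 2026-08-21) in the materialised text layer.

CITATION HEADER (lean-in-tree rule 2026-08-18).  WHAT IS REPRODUCED: the sentence structure of (26)–(28) p. 282 —
«This expansion gives A(U₁U₀) = A(U₀) + Σ_{p⊂Ω₀} η^{d−2} Im tr(DA)(p)U₀(∂p) + ½⟨A, ΔA⟩ + V₀(A), (26) where the expansion
of V₀(A) begins with a third order polynomial. From hermiticity of DA we have Σ_{p⊂Ω₀} η^{d−2} Im tr(DA)(p)U₀(∂p) =
… = ⟨A, J⟩, (27)» — READ AS A STATEMENT ABOUT THE FIRST VARIATION OF THE WILSON ACTION AT THE BACKGROUND: the map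
`A ↦ A(U₁U₀)`, `U₁ = exp iηA`, is Fréchet differentiable at `A = 0` with derivative the pairing `A ↦ ⟨A, J⟩`, the
remaining terms `½⟨A, ΔA⟩ + V₀(A)` of (26) being of second order at `0` (derivative `0`).  This is the form in which
(26) is USED on p. 260 of [Balaban1985UV3] (= B10, before its (19)): «The function in the exponential … has a minimum
at A = 0. This implies that a linear term in its expansion vanishes» — the tree's `B10Eq19LinearTerm`
(`inner_J_eq_zero_of_expansion26`, seat r07) takes exactly the hypotheses `h26`/`hDt`/`hq` produced in §5 below.
Row of `HOME/lit-balaban-r08/ROWS-B11.md`: **B11.Eq24** (displays (24)–(26); cell rider, head unchanged) and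
**B11.Eq27** ((27)–(28)).  Siblings (imported, nothing re-declared): `B11Eq26ActionExpansion` ((26) `eq26`, `V0`,
`norm_V0_le_cubic`), `B11Eq27Current` ((27) `eq27`), `B9Eq369Product` (`prodCfg_zero`), and the carrier `B9Eq39Adjoint` of [5] (3.10)–(3.12) (`action`,
`prodCfg`, `bondPair`, `J`, `hessPair`, `lettersA`).

DICTIONARY.  As in `B11Eq26ActionExpansion`: `𝔸` a normed `ℂ`-algebra (the `N × N` matrices), sites `S`, directions
`ι`, shifts `T`, background `U ↦ U : ι → S → 𝔸ˣ` (arbitrary units), `A : ι → S → 𝔸` a bond field with the SUP NORM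
`‖A‖ = sup_b ‖A(b)‖` (the `Pi` norm), `A(·) ↦ action T η d τ`, `U₁U₀ ↦ prodCfg U η A`, `⟨A, E⟩ ↦ bondPair η d τ A E`,
`⟨A, ΔA⟩ ↦ hessPair`, `tr ↦` a continuous tracial `τ : 𝔸 →L[ℂ] ℂ`; `η ≠ 0`, `4 ≦ d` where [5] (3.12) is invoked
(the natural-number exponent `η^{d−4}` of the carrier, faithful for `d ≧ 4`).

WHAT IS CERTIFIED (kernel, sorry-free; theorems only; axioms `propext`/`Classical.choice`/`Quot.sound`).
* §1 [folklore] calculus (private helpers): a map with `‖q(A)‖ ≦ C‖A‖²` near `0` (or `≦ C‖A‖³` on the unit ball) has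
  Fréchet derivative `0` at `0`.
* §2 sizes: `size_lettersA_le` — `Σ_{b⊂∂p}‖A′(b)‖ ≦ c_p(U₀)·‖A‖`, `c_p = 2 + ‖U₀(x,w)‖‖U₀(x,w)⁻¹‖ + ‖U₀(x,y)‖‖U₀(x,y)⁻¹‖`.
* §3 `exists_clm_bondPair` — the pairing `A ↦ ⟨A, E⟩` IS a continuous `ℂ`-linear functional (so «⟨·, J⟩» is one).
* §4 «½⟨A, ΔA⟩ + V₀(A)» IS OF SECOND ORDER AT `0`: `norm_hessPair_le_sq` (`‖⟨A, ΔA⟩‖ ≦ K·‖A‖²`),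
  `norm_V0_le_cube` (`‖V₀(A)‖ ≦ K·‖A‖³` for `‖A‖ ≦ 1` — «the expansion of V₀(A) begins with a third order polynomial»,
  uniformly in the direction), `hasFDerivAt_hessPair_zero`, `hasFDerivAt_V0_zero`.
* §5 **(26)–(28) AS THE FIRST VARIATION**: **`hasFDerivAt_action_prodCfg`** — `(δ/δA) A(U₁U₀)|_{A=0} = ⟨·, J⟩`
  (existence of the functional `φ` with `φ A = ⟨A, J⟩` and `HasFDerivAt (A ↦ A(U₁U₀)) φ 0`); **`expansion26`** — the
  complex form `A(U₁U₀) = A(U₀) + φ(A) + q(A)`, `HasFDerivAt q 0 0`; **`expansion26_real`** — the REAL form used on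
  p. 260 of [Balaban1985UV3]: for any `D̃` with `D̃(0) = 0`, `D̃′(0) = 0`, the real function `f(A) = Re A(exp iη(A −
  D̃A)·U₀)` satisfies `f(A) = f(0) + φ_ℝ(A − D̃A) + q(A)` with `φ_ℝ = Re⟨·, J⟩` continuous `ℝ`-linear and `HasFDerivAt
  q 0 0` — literally the hypotheses `h26`, `hq` of `B10Eq19LinearTerm.inner_J_eq_zero_of_expansion26`.
* §6 (27)–(28) «from hermiticity»: on the unitary group, for Hermitian `A` and a `*`-compatible trace `⟨A, J⟩` is
  REAL (`bondPair_J_im_eq_zero`), so `Re⟨A, J⟩ = 0 ⟹ ⟨A, J⟩ = 0` (`bondPair_J_eq_zero_of_re`) — the conclusion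
  «⟨A, J⟩ = 0 on the constraint space» of p. 260 [Balaban1985UV3] from the real Fermat statement.

HONEST SCOPE — what is NOT claimed.  (i) Nothing of B10's minimality (its (12)) or of the constraint preservation is
touched: §5 only supplies the B11 side of that knit; the one-line application lives with the B10 rows (seat r07).
(ii) The constants `K` of §4 are existential (finite lattice; they depend on `U₀`, `η`, `τ`, `d` and the lattice) —
the paper needs no uniformity here.  (iii) `4 ≦ d`, `η ≠ 0` as in `B11Eq26ActionExpansion` ([5] (3.12) bookkeeping);
the background is arbitrary (no smallness, no unitarity) except in §6.  (iv) Not summit progress.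
-/

noncomputable section

open NormedSpace Complex Finset Filter Topology Asymptotics

namespace Literature.MathematicalPhysics.QuantumFieldTheory.Balaban1983to89.B11Eq26FirstVariation

open Literature.MathematicalPhysics.QuantumFieldTheory.Balaban1983to89.Beta.TransportVertices
open Literature.MathematicalPhysics.QuantumFieldTheory.Balaban1983to89.Beta.AdjointTransportJets
open Literature.MathematicalPhysics.QuantumFieldTheory.Balaban1983to89.B9Eq37Insertion
open Literature.MathematicalPhysics.QuantumFieldTheory.Balaban1983to89.B9Eq39Adjoint
open B11Eq26ActionExpansion (V0 eq26 norm_V0_le_cubic)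

/-! ## §1 A map bounded by `C‖A‖²` near `0` has derivative `0` at `0` -/

section Calculus

variable {𝕜 : Type*} [NontriviallyNormedField 𝕜] {E F : Type*} [NormedAddCommGroup E] [NormedSpace 𝕜 E]
  [NormedAddCommGroup F] [NormedSpace 𝕜 F]

/-- A map with `‖q(A)‖ ≦ C‖A‖²` on a ball around `0` vanishes at `0` and has Fréchet derivative `0` there (the
quadratic bound is a little-o of `‖A‖`). [folklore] -/
private theorem hasFDerivAt_zero_of_norm_le_mul_sq {q : E → F} {C r : ℝ} (hr : 0 < r)
    (hq : ∀ A : E, ‖A‖ < r → ‖q A‖ ≤ C * ‖A‖ ^ 2) : HasFDerivAt q (0 : E →L[𝕜] F) 0 := by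
  have hq0 : q 0 = 0 := by
    have h := hq 0 (by rwa [norm_zero])
    rw [norm_zero, zero_pow two_ne_zero, mul_zero] at h
    exact norm_le_zero_iff.1 h
  rw [hasFDerivAt_iff_isLittleO_nhds_zero]
  simp only [zero_add, hq0, sub_zero, zero_apply]
  refine IsLittleO.of_bound fun ε hε => ?_
  have hC : 0 < max C 1 := lt_max_of_lt_right one_pos
  have hδ : 0 < min r (ε / max C 1) := lt_min hr (div_pos hε hC)
  filter_upwards [Metric.ball_mem_nhds (0 : E) hδ] with h hh
  rw [mem_ball_zero_iff, lt_min_iff] at hh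
  calc ‖q h‖ ≤ C * ‖h‖ ^ 2 := hq h hh.1
    _ ≤ max C 1 * ‖h‖ ^ 2 := mul_le_mul_of_nonneg_right (le_max_left C 1) (by positivity)
    _ = (max C 1 * ‖h‖) * ‖h‖ := by ring
    _ ≤ (max C 1 * (ε / max C 1)) * ‖h‖ := by gcongr; exact hh.2.le
    _ = ε * ‖h‖ := by field_simp

/-- The cubic case: `‖q(A)‖ ≦ C‖A‖³` for `‖A‖ ≦ 1` also gives derivative `0` at `0`. [folklore] -/
private theorem hasFDerivAt_zero_of_norm_le_mul_cube {q : E → F} {C : ℝ} (hC : 0 ≤ C)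
    (hq : ∀ A : E, ‖A‖ ≤ 1 → ‖q A‖ ≤ C * ‖A‖ ^ 3) : HasFDerivAt q (0 : E →L[𝕜] F) 0 := by
  refine hasFDerivAt_zero_of_norm_le_mul_sq (C := C) one_pos fun A hA => (hq A hA.le).trans ?_
  have h3 : ‖A‖ ^ 3 ≤ ‖A‖ ^ 2 := pow_le_pow_of_le_one (norm_nonneg A) hA.le (by norm_num)
  exact mul_le_mul_of_nonneg_left h3 hC

end Calculus

/-! ## §2 Sizes: the letters `A′(b)` of a plaquette against the sup norm of `A` -/

section Sizes

variable {𝔸 : Type*} [NormedRing 𝔸] [NormedAlgebra ℂ 𝔸]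
variable {S : Type*} {ι : Type*}
variable (T : ι → Equiv.Perm S) (U : ι → S → 𝔸ˣ)

omit [NormedAlgebra ℂ 𝔸] in
/-- A transported letter: `‖R(V)X‖ = ‖V X V⁻¹‖ ≦ ‖V‖‖V⁻¹‖‖X‖`. [folklore] -/
private theorem norm_R_le (V : 𝔸ˣ) (X : 𝔸) : ‖R V X‖ ≤ ‖(V : 𝔸)‖ * ‖((V⁻¹ : 𝔸ˣ) : 𝔸)‖ * ‖X‖ := by
  rw [R_def]
  calc ‖(V : 𝔸) * X * ((V⁻¹ : 𝔸ˣ) : 𝔸)‖ ≤ ‖(V : 𝔸) * X‖ * ‖((V⁻¹ : 𝔸ˣ) : 𝔸)‖ := norm_mul_le _ _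
    _ ≤ ‖(V : 𝔸)‖ * ‖X‖ * ‖((V⁻¹ : 𝔸ˣ) : 𝔸)‖ := by gcongr; exact norm_mul_le _ _
    _ = _ := by ring

omit [NormedAlgebra ℂ 𝔸] in
/-- `‖A(b)‖ ≦ ‖A‖` for the sup norm of the bond field. [folklore] -/
private theorem norm_apply_le_norm [Fintype S] [Fintype ι] (A : ι → S → 𝔸) (μ : ι) (x : S) : ‖A μ x‖ ≤ ‖A‖ :=
  (norm_le_pi_norm (A μ) x).trans (norm_le_pi_norm A μ)

omit [NormedAlgebra ℂ 𝔸] in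
/-- **`Σ_{b⊂∂p}‖A′(b)‖ ≦ c_p(U₀)·‖A‖`** with `c_p = ‖U₀(x,w)‖‖U₀(x,w)⁻¹‖ + 1 + 1 + ‖U₀(x,y)‖‖U₀(x,y)⁻¹‖` for the four
letters of (25) `R(U₀(x,w))A(z,w)`, `A(w,x)`, `A(x,y)`, `R(U₀(x,y))A(y,z)` (`B9Eq39Adjoint.lettersA`).
[cite: Balaban1985Variational, (25) p.282] -/
theorem size_lettersA_le [Fintype S] [Fintype ι] (A : ι → S → 𝔸) (μ ν : ι) (x : S) :
    size (lettersA T U A μ ν x)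
      ≤ (‖(U ν x : 𝔸)‖ * ‖(((U ν x)⁻¹ : 𝔸ˣ) : 𝔸)‖ + 1 + 1 + ‖(U μ x : 𝔸)‖ * ‖(((U μ x)⁻¹ : 𝔸ˣ) : 𝔸)‖)
          * ‖A‖ := by
  have h1 : ‖R (U ν x) (A μ (T ν x))‖ ≤ ‖(U ν x : 𝔸)‖ * ‖(((U ν x)⁻¹ : 𝔸ˣ) : 𝔸)‖ * ‖A‖ :=
    (norm_R_le (U ν x) _).trans (mul_le_mul_of_nonneg_left (norm_apply_le_norm A μ (T ν x)) (by positivity))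
  have h2 : ‖A ν x‖ ≤ 1 * ‖A‖ := by rw [one_mul]; exact norm_apply_le_norm A ν x
  have h3 : ‖A μ x‖ ≤ 1 * ‖A‖ := by rw [one_mul]; exact norm_apply_le_norm A μ x
  have h4 : ‖R (U μ x) (A ν (T μ x))‖ ≤ ‖(U μ x : 𝔸)‖ * ‖(((U μ x)⁻¹ : 𝔸ˣ) : 𝔸)‖ * ‖A‖ :=
    (norm_R_le (U μ x) _).trans (mul_le_mul_of_nonneg_left (norm_apply_le_norm A ν (T μ x)) (by positivity))
  simp only [lettersA, size, List.map_cons, List.map_nil, List.sum_cons, List.sum_nil, norm_neg]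
  linarith

omit [NormedAlgebra ℂ 𝔸] in
/-- The constant `c_p(U₀)` is nonnegative. [folklore] -/
private theorem cst_nonneg (μ ν : ι) (x : S) :
    0 ≤ ‖(U ν x : 𝔸)‖ * ‖(((U ν x)⁻¹ : 𝔸ˣ) : 𝔸)‖ + 1 + 1 + ‖(U μ x : 𝔸)‖ * ‖(((U μ x)⁻¹ : 𝔸ˣ) : 𝔸)‖ := by
  positivity

omit [NormedAlgebra ℂ 𝔸] in
/-- `‖(D¹_U A)(p)‖ ≦ Σ_{b⊂∂p}‖A′(b)‖` — (3.4) of [5] read with (3.2)/(3.5): the curl is the letter sum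
(`B9Eq39Adjoint.sum_lettersA`). [folklore] [cite: Balaban1985BackgroundPropagators, (3.4) p.391, (3.2) p.390] -/
theorem norm_curl_le_size (A : ι → S → 𝔸) (μ ν : ι) (x : S) :
    ‖curl T U A μ ν x‖ ≤ size (lettersA T U A μ ν x) := by
  rw [← sum_lettersA]
  exact norm_sum_le_size _

end Sizes

/-! ## §3 The pairing `A ↦ ⟨A, E⟩` is a continuous linear functional -/

section Pairing

variable {𝔸 : Type*} [NormedRing 𝔸] [NormedAlgebra ℂ 𝔸]
variable {S : Type*} [Fintype S] {ι : Type*} [Fintype ι]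

/-- **«⟨·, J⟩» IS A CONTINUOUS LINEAR FUNCTIONAL**: for a continuous `τ` and any bond field `E`, the pairing
`A ↦ ⟨A, E⟩ = η^d Σ_b tr A(b)E(b)` of [5] (3.11) is a continuous `ℂ`-linear functional of `A` (finite sum of
`tr ∘ (· E(b)) ∘ ev_b`). [cite: Balaban1985Variational, (27) p.282] [cite: Balaban1985BackgroundPropagators, (3.11) p.392] -/
theorem exists_clm_bondPair (τ : 𝔸 →L[ℂ] ℂ) (η : ℝ) (d : ℕ) (E : ι → S → 𝔸) :
    ∃ φ : (ι → S → 𝔸) →L[ℂ] ℂ, ∀ A, φ A = bondPair η d (τ : 𝔸 →ₗ[ℂ] ℂ) A E := by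
  classical
  let ev : ι → S → ((ι → S → 𝔸) →L[ℂ] 𝔸) := fun μ x =>
    (ContinuousLinearMap.proj (R := ℂ) (φ := fun _ : S => 𝔸) x).comp
      (ContinuousLinearMap.proj (R := ℂ) (φ := fun _ : ι => S → 𝔸) μ)
  let ψ : (ι → S → 𝔸) →L[ℂ] ℂ :=
    ((η : ℂ) ^ d) • ∑ x : S, ∑ μ : ι, τ.comp (((ContinuousLinearMap.mul ℂ 𝔸).flip (E μ x)).comp (ev μ x))
  refine ⟨ψ, fun A => ?_⟩
  simp only [ψ, ev, bondPair, smul_apply, FunLike.coe_sum, Finset.sum_apply,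
    ContinuousLinearMap.coe_comp, Function.comp_apply, ContinuousLinearMap.proj_apply,
    ContinuousLinearMap.flip_apply, ContinuousLinearMap.mul_apply', ContinuousLinearMap.coe_coe, smul_eq_mul]

end Pairing

/-! ## §4 «½⟨A, ΔA⟩ + V₀(A)» is of second order at `A = 0` -/

section SecondOrder

variable {𝔸 : Type*} [NormedRing 𝔸] [NormedAlgebra ℂ 𝔸] [CompleteSpace 𝔸]
variable {S : Type*} [Fintype S] {ι : Type*} [Fintype ι] [LinearOrder ι]
variable (T : ι → Equiv.Perm S) (U : ι → S → 𝔸ˣ)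

omit [CompleteSpace 𝔸] [Fintype S] [Fintype ι] [LinearOrder ι] in
/-- ONE PLAQUETTE OF `⟨A, ΔA⟩` ((3.10) of [5]: the `D*D` term `tr X²`, `X = (D^η A)(p)`, and the two `Δ′` terms
`tr (D¹A)²η⁻²(Re U₀(∂p) − 1)`, `tr i·Σ_{b₁≺b₂}[A′(b₁),A′(b₂)]·η⁻² Im U₀(∂p)`) is QUADRATIC in the letter size
`s_p = Σ_{b⊂∂p}‖A′(b)‖`: bounded by `‖τ‖(‖η⁻¹‖² + ‖η⁻²‖‖Re U₀(∂p) − 1‖ + ‖η⁻²‖‖Im U₀(∂p)‖)·s_p²`. [folklore]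
[cite: Balaban1985Variational, (26) p.282] [cite: Balaban1985BackgroundPropagators, (3.10) p.392] -/
theorem norm_hessSummand_le (τ : 𝔸 →L[ℂ] ℂ) (η : ℝ) (A : ι → S → 𝔸) (μ ν : ι) (x : S) :
    ‖τ (curlη T U η A μ ν x * curlη T U η A μ ν x)
        + (τ (curl T U A μ ν x * curl T U A μ ν x * ((((η : ℂ)⁻¹) ^ 2) • (reC (plaqU T U μ ν x) - 1)))
          + τ ((I • commSum (lettersA T U A μ ν x)) * ((((η : ℂ)⁻¹) ^ 2) • imC (plaqU T U μ ν x))))‖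
      ≤ ‖τ‖ * (‖((η : ℂ)⁻¹)‖ ^ 2 + ‖((η : ℂ)⁻¹) ^ 2‖ * ‖reC (plaqU T U μ ν x) - 1‖
            + ‖((η : ℂ)⁻¹) ^ 2‖ * ‖imC (plaqU T U μ ν x)‖) * size (lettersA T U A μ ν x) ^ 2 := by
  set s := size (lettersA T U A μ ν x) with hs_def
  have hs : 0 ≤ s := size_nonneg _
  have hc : ‖curl T U A μ ν x‖ ≤ s := norm_curl_le_size T U A μ ν x
  have hcη : ‖curlη T U η A μ ν x‖ ≤ ‖((η : ℂ)⁻¹)‖ * s := by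
    rw [curlη, norm_smul]
    exact mul_le_mul_of_nonneg_left hc (norm_nonneg _)
  have hcc : ‖curl T U A μ ν x * curl T U A μ ν x‖ ≤ s ^ 2 := by
    rw [sq]
    exact (norm_mul_le _ _).trans (mul_le_mul hc hc (norm_nonneg _) hs)
  have t1 : ‖τ (curlη T U η A μ ν x * curlη T U η A μ ν x)‖ ≤ ‖τ‖ * (‖((η : ℂ)⁻¹)‖ * s) ^ 2 := by
    refine (τ.le_opNorm _).trans (mul_le_mul_of_nonneg_left ?_ (norm_nonneg _))
    rw [sq]
    exact (norm_mul_le _ _).trans (mul_le_mul hcη hcη (norm_nonneg _) (by positivity))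
  have t2 : ‖τ (curl T U A μ ν x * curl T U A μ ν x * ((((η : ℂ)⁻¹) ^ 2) • (reC (plaqU T U μ ν x) - 1)))‖
      ≤ ‖τ‖ * (s ^ 2 * (‖((η : ℂ)⁻¹) ^ 2‖ * ‖reC (plaqU T U μ ν x) - 1‖)) := by
    refine (τ.le_opNorm _).trans (mul_le_mul_of_nonneg_left ?_ (norm_nonneg _))
    refine (norm_mul_le _ _).trans ?_
    rw [norm_smul]
    exact mul_le_mul hcc le_rfl (by positivity) (sq_nonneg _)
  have t3 : ‖τ ((I • commSum (lettersA T U A μ ν x)) * ((((η : ℂ)⁻¹) ^ 2) • imC (plaqU T U μ ν x)))‖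
      ≤ ‖τ‖ * (s ^ 2 * (‖((η : ℂ)⁻¹) ^ 2‖ * ‖imC (plaqU T U μ ν x)‖)) := by
    refine (τ.le_opNorm _).trans (mul_le_mul_of_nonneg_left ?_ (norm_nonneg _))
    refine (norm_mul_le _ _).trans ?_
    rw [norm_smul, norm_smul, Complex.norm_I, one_mul]
    exact mul_le_mul (norm_commSum_le _) le_rfl (by positivity) (sq_nonneg _)
  calc _ ≤ ‖τ (curlη T U η A μ ν x * curlη T U η A μ ν x)‖
        + (‖τ (curl T U A μ ν x * curl T U A μ ν x * ((((η : ℂ)⁻¹) ^ 2) • (reC (plaqU T U μ ν x) - 1)))‖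
          + ‖τ ((I • commSum (lettersA T U A μ ν x)) * ((((η : ℂ)⁻¹) ^ 2) • imC (plaqU T U μ ν x)))‖) :=
        (norm_add_le _ _).trans (add_le_add le_rfl (norm_add_le _ _))
    _ ≤ ‖τ‖ * (‖((η : ℂ)⁻¹)‖ * s) ^ 2
        + (‖τ‖ * (s ^ 2 * (‖((η : ℂ)⁻¹) ^ 2‖ * ‖reC (plaqU T U μ ν x) - 1‖))
          + ‖τ‖ * (s ^ 2 * (‖((η : ℂ)⁻¹) ^ 2‖ * ‖imC (plaqU T U μ ν x)‖))) := add_le_add t1 (add_le_add t2 t3)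
    _ = _ := by ring

omit [CompleteSpace 𝔸] in
/-- **`‖⟨A, ΔA⟩‖ ≦ |η|^d Σ_p k_p(U₀,η,τ)·s_p(A)²`** — the quadratic form of (26) plaquette by plaquette (via (3.9)–(3.10) of
[5]: `B9Eq39Adjoint.bondPair_divPη_curlη` for the `D*D` part, `deltaPrime` for `Δ′`). [folklore]
[cite: Balaban1985Variational, (26) p.282] [cite: Balaban1985BackgroundPropagators, (3.10) p.392] -/
theorem norm_hessPair_le (τ : 𝔸 →L[ℂ] ℂ) (hτ : ∀ a b : 𝔸, τ (a * b) = τ (b * a)) (η : ℝ) (d : ℕ)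
    (A : ι → S → 𝔸) :
    ‖hessPair T U η d (τ : 𝔸 →ₗ[ℂ] ℂ) A‖
      ≤ ‖(η : ℂ) ^ d‖ * ∑ q ∈ posPlaq S ι,
          ‖τ‖ * (‖((η : ℂ)⁻¹)‖ ^ 2 + ‖((η : ℂ)⁻¹) ^ 2‖ * ‖reC (plaqU T U q.2.1 q.2.2 q.1) - 1‖
              + ‖((η : ℂ)⁻¹) ^ 2‖ * ‖imC (plaqU T U q.2.1 q.2.2 q.1)‖)
            * size (lettersA T U A q.2.1 q.2.2 q.1) ^ 2 := by
  have hrw : hessPair T U η d (τ : 𝔸 →ₗ[ℂ] ℂ) A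
      = (η : ℂ) ^ d * ∑ q ∈ posPlaq S ι,
          (τ (curlη T U η A q.2.1 q.2.2 q.1 * curlη T U η A q.2.1 q.2.2 q.1)
            + (τ (curl T U A q.2.1 q.2.2 q.1 * curl T U A q.2.1 q.2.2 q.1
                * ((((η : ℂ)⁻¹) ^ 2) • (reC (plaqU T U q.2.1 q.2.2 q.1) - 1)))
              + τ ((I • commSum (lettersA T U A q.2.1 q.2.2 q.1))
                * ((((η : ℂ)⁻¹) ^ 2) • imC (plaqU T U q.2.1 q.2.2 q.1))))) := by
    rw [hessPair, bondPair_divPη_curlη T U (τ : 𝔸 →ₗ[ℂ] ℂ) hτ η d A, deltaPrime, ← mul_add,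
      ← Finset.sum_add_distrib]
    rfl
  rw [hrw, norm_mul]
  refine mul_le_mul_of_nonneg_left ((norm_sum_le _ _).trans (Finset.sum_le_sum fun q _ => ?_)) (norm_nonneg _)
  exact norm_hessSummand_le T U τ η A q.2.1 q.2.2 q.1

omit [CompleteSpace 𝔸] in
/-- **`⟨A, ΔA⟩ = O(‖A‖²)` UNIFORMLY**: `∃ K ≧ 0, ∀ A, ‖⟨A, ΔA⟩‖ ≦ K‖A‖²` (finite lattice; `K` depends on `U₀`, `η`,
`τ`, `d`). [folklore] [cite: Balaban1985Variational, (26) p.282] -/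
theorem norm_hessPair_le_sq (τ : 𝔸 →L[ℂ] ℂ) (hτ : ∀ a b : 𝔸, τ (a * b) = τ (b * a)) (η : ℝ) (d : ℕ) :
    ∃ K : ℝ, 0 ≤ K ∧ ∀ A : ι → S → 𝔸, ‖hessPair T U η d (τ : 𝔸 →ₗ[ℂ] ℂ) A‖ ≤ K * ‖A‖ ^ 2 := by
  classical
  let k : S × ι × ι → ℝ := fun q =>
    ‖τ‖ * (‖((η : ℂ)⁻¹)‖ ^ 2 + ‖((η : ℂ)⁻¹) ^ 2‖ * ‖reC (plaqU T U q.2.1 q.2.2 q.1) - 1‖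
      + ‖((η : ℂ)⁻¹) ^ 2‖ * ‖imC (plaqU T U q.2.1 q.2.2 q.1)‖)
  let c : S × ι × ι → ℝ := fun q =>
    ‖(U q.2.2 q.1 : 𝔸)‖ * ‖(((U q.2.2 q.1)⁻¹ : 𝔸ˣ) : 𝔸)‖ + 1 + 1
      + ‖(U q.2.1 q.1 : 𝔸)‖ * ‖(((U q.2.1 q.1)⁻¹ : 𝔸ˣ) : 𝔸)‖
  have hk : ∀ q, 0 ≤ k q := fun q => by positivity
  have hc : ∀ q, 0 ≤ c q := fun q => cst_nonneg U q.2.1 q.2.2 q.1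
  refine ⟨‖(η : ℂ) ^ d‖ * ∑ q ∈ posPlaq S ι, k q * c q ^ 2,
    mul_nonneg (norm_nonneg _) (Finset.sum_nonneg fun q _ => by positivity), fun A => ?_⟩
  refine (norm_hessPair_le T U τ hτ η d A).trans ?_
  rw [mul_assoc, Finset.sum_mul]
  refine mul_le_mul_of_nonneg_left (Finset.sum_le_sum fun q _ => ?_) (norm_nonneg _)
  have hsz : size (lettersA T U A q.2.1 q.2.2 q.1) ≤ c q * ‖A‖ := size_lettersA_le T U A q.2.1 q.2.2 q.1
  have hsq : size (lettersA T U A q.2.1 q.2.2 q.1) ^ 2 ≤ (c q * ‖A‖) ^ 2 :=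
    pow_le_pow_left₀ (size_nonneg _) hsz 2
  calc k q * size (lettersA T U A q.2.1 q.2.2 q.1) ^ 2 ≤ k q * (c q * ‖A‖) ^ 2 :=
        mul_le_mul_of_nonneg_left hsq (hk q)
    _ = k q * c q ^ 2 * ‖A‖ ^ 2 := by ring

/-- **«THE EXPANSION OF V₀(A) BEGINS WITH A THIRD ORDER POLYNOMIAL», UNIFORMLY**: `∃ K ≧ 0, ∀ A, ‖A‖ ≦ 1 →
‖V₀(A)‖ ≦ K‖A‖³` (from `B11Eq26ActionExpansion.norm_V0_le_cubic` and §2). [cite: Balaban1985Variational, (26) p.282] -/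
theorem norm_V0_le_cube (τ : 𝔸 →L[ℂ] ℂ) (hτ : ∀ a b : 𝔸, τ (a * b) = τ (b * a)) (η : ℝ) (hη : η ≠ 0) {d : ℕ}
    (hd : 4 ≤ d) :
    ∃ K : ℝ, 0 ≤ K ∧ ∀ A : ι → S → 𝔸, ‖A‖ ≤ 1 → ‖V0 T U η d (τ : 𝔸 →ₗ[ℂ] ℂ) A‖ ≤ K * ‖A‖ ^ 3 := by
  classical
  let m : S × ι × ι → ℝ := fun q =>
    2⁻¹ * ‖τ‖ * (‖(plaqU T U q.2.1 q.2.2 q.1 : 𝔸)‖ + ‖(((plaqU T U q.2.1 q.2.2 q.1)⁻¹ : 𝔸ˣ) : 𝔸)‖)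
  let c : S × ι × ι → ℝ := fun q =>
    ‖(U q.2.2 q.1 : 𝔸)‖ * ‖(((U q.2.2 q.1)⁻¹ : 𝔸ˣ) : 𝔸)‖ + 1 + 1
      + ‖(U q.2.1 q.1 : 𝔸)‖ * ‖(((U q.2.1 q.1)⁻¹ : 𝔸ˣ) : 𝔸)‖
  have hm : ∀ q, 0 ≤ m q := fun q => by positivity
  have hc : ∀ q, 0 ≤ c q := fun q => cst_nonneg U q.2.1 q.2.2 q.1
  refine ⟨|η| ^ (d - 4) * ∑ q ∈ posPlaq S ι, m q * ((|η| * c q) ^ 3 / 6 * Real.exp (|η| * c q)),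
    mul_nonneg (by positivity) (Finset.sum_nonneg fun q _ => by positivity), fun A hA => ?_⟩
  refine (norm_V0_le_cubic T U τ hτ η hη hd A).trans ?_
  rw [mul_assoc, Finset.sum_mul]
  refine mul_le_mul_of_nonneg_left (Finset.sum_le_sum fun q _ => ?_) (by positivity)
  have hsz : size (lettersA T U A q.2.1 q.2.2 q.1) ≤ c q * ‖A‖ := size_lettersA_le T U A q.2.1 q.2.2 q.1
  have hsz1 : size (lettersA T U A q.2.1 q.2.2 q.1) ≤ c q :=
    hsz.trans (mul_le_of_le_one_right (hc q) hA)
  have hs0 : 0 ≤ size (lettersA T U A q.2.1 q.2.2 q.1) := size_nonneg _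
  have hexp : Real.exp (|η| * size (lettersA T U A q.2.1 q.2.2 q.1)) ≤ Real.exp (|η| * c q) :=
    Real.exp_le_exp.2 (mul_le_mul_of_nonneg_left hsz1 (abs_nonneg η))
  have hcube : (|η| * size (lettersA T U A q.2.1 q.2.2 q.1)) ^ 3 ≤ (|η| * (c q * ‖A‖)) ^ 3 :=
    pow_le_pow_left₀ (by positivity) (mul_le_mul_of_nonneg_left hsz (abs_nonneg η)) 3
  calc m q * ((|η| * size (lettersA T U A q.2.1 q.2.2 q.1)) ^ 3 / 6
          * Real.exp (|η| * size (lettersA T U A q.2.1 q.2.2 q.1)))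
      ≤ m q * ((|η| * (c q * ‖A‖)) ^ 3 / 6 * Real.exp (|η| * c q)) := by
        refine mul_le_mul_of_nonneg_left ?_ (hm q)
        gcongr
    _ = m q * ((|η| * c q) ^ 3 / 6 * Real.exp (|η| * c q)) * ‖A‖ ^ 3 := by ring

omit [CompleteSpace 𝔸] in
/-- `⟨·, Δ·⟩` has Fréchet derivative `0` at `A = 0`. [folklore] [cite: Balaban1985Variational, (26) p.282] -/
theorem hasFDerivAt_hessPair_zero (τ : 𝔸 →L[ℂ] ℂ) (hτ : ∀ a b : 𝔸, τ (a * b) = τ (b * a)) (η : ℝ) (d : ℕ) :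
    HasFDerivAt (fun A : ι → S → 𝔸 => hessPair T U η d (τ : 𝔸 →ₗ[ℂ] ℂ) A)
      (0 : (ι → S → 𝔸) →L[ℂ] ℂ) 0 := by
  obtain ⟨K, -, hK⟩ := norm_hessPair_le_sq T U τ hτ η d
  exact hasFDerivAt_zero_of_norm_le_mul_sq one_pos fun A _ => hK A

/-- `V₀` has Fréchet derivative `0` at `A = 0` («begins with a third order polynomial»).
[cite: Balaban1985Variational, (26) p.282] -/
theorem hasFDerivAt_V0_zero (τ : 𝔸 →L[ℂ] ℂ) (hτ : ∀ a b : 𝔸, τ (a * b) = τ (b * a)) (η : ℝ) (hη : η ≠ 0)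
    {d : ℕ} (hd : 4 ≤ d) :
    HasFDerivAt (fun A : ι → S → 𝔸 => V0 T U η d (τ : 𝔸 →ₗ[ℂ] ℂ) A) (0 : (ι → S → 𝔸) →L[ℂ] ℂ) 0 := by
  obtain ⟨K, hK0, hK⟩ := norm_V0_le_cube T U τ hτ η hη hd
  exact hasFDerivAt_zero_of_norm_le_mul_cube hK0 hK

end SecondOrder

/-! ## §5 (26)–(28) as the first variation of the action at the background -/

section FirstVariation

variable {𝔸 : Type*} [NormedRing 𝔸] [NormedAlgebra ℂ 𝔸] [CompleteSpace 𝔸]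
variable {S : Type*} [Fintype S] {ι : Type*} [Fintype ι] [LinearOrder ι]
variable (T : ι → Equiv.Perm S) (U : ι → S → 𝔸ˣ)

/-- **(26)–(28): `J` IS THE FIRST VARIATION OF THE WILSON ACTION AT `U₀`** — the map `A ↦ A(U₁U₀)`, `U₁ = exp iηA`,
is Fréchet differentiable at `A = 0` with derivative the continuous linear functional `A ↦ ⟨A, J⟩` (the linear term
of (26), identified by (27)); the other terms of (26) have derivative `0` at `0`.
[cite: Balaban1985Variational, (26)-(28) p.282] -/
theorem hasFDerivAt_action_prodCfg (τ : 𝔸 →L[ℂ] ℂ) (hτ : ∀ a b : 𝔸, τ (a * b) = τ (b * a)) (η : ℝ) (hη : η ≠ 0)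
    {d : ℕ} (hd : 4 ≤ d) :
    ∃ φ : (ι → S → 𝔸) →L[ℂ] ℂ, (∀ A, φ A = bondPair η d (τ : 𝔸 →ₗ[ℂ] ℂ) A (J T U η)) ∧
      HasFDerivAt (fun A : ι → S → 𝔸 => action T η d (τ : 𝔸 →ₗ[ℂ] ℂ) (prodCfg U η A)) φ 0 := by
  obtain ⟨φ, hφ⟩ := exists_clm_bondPair τ η d (J T U η)
  refine ⟨φ, hφ, ?_⟩
  have hfun : (fun A : ι → S → 𝔸 => action T η d (τ : 𝔸 →ₗ[ℂ] ℂ) (prodCfg U η A))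
      = fun A => action T η d (τ : 𝔸 →ₗ[ℂ] ℂ) U + φ A
          + ((2 : ℂ)⁻¹ * hessPair T U η d (τ : 𝔸 →ₗ[ℂ] ℂ) A + V0 T U η d (τ : 𝔸 →ₗ[ℂ] ℂ) A) := by
    funext A
    rw [eq26 T U η d (τ : 𝔸 →ₗ[ℂ] ℂ) A, hφ A]
    ring
  rw [hfun]
  have h2 := ((hasFDerivAt_hessPair_zero T U τ hτ η d).const_mul (2 : ℂ)⁻¹).add
    (hasFDerivAt_V0_zero T U τ hτ η hη hd)
  have h := ((hasFDerivAt_const (action T η d (τ : 𝔸 →ₗ[ℂ] ℂ) U) (0 : ι → S → 𝔸)).add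
    φ.hasFDerivAt).add h2
  exact h.congr_fderiv (by simp)

/-- **(26) IN FIRST-ORDER FORM (complex)**: `A(U₁U₀) = A(U₀) + φ(A) + q(A)` for ALL `A`, with `φ = ⟨·, J⟩` continuous
linear and `q = ½⟨A, ΔA⟩ + V₀(A)` of derivative `0` at `0`. [cite: Balaban1985Variational, (26)-(27) p.282] -/
theorem expansion26 (τ : 𝔸 →L[ℂ] ℂ) (hτ : ∀ a b : 𝔸, τ (a * b) = τ (b * a)) (η : ℝ) (hη : η ≠ 0) {d : ℕ}
    (hd : 4 ≤ d) :
    ∃ (φ : (ι → S → 𝔸) →L[ℂ] ℂ) (q : (ι → S → 𝔸) → ℂ),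
      (∀ A, φ A = bondPair η d (τ : 𝔸 →ₗ[ℂ] ℂ) A (J T U η)) ∧ HasFDerivAt q (0 : (ι → S → 𝔸) →L[ℂ] ℂ) 0 ∧
      ∀ A, action T η d (τ : 𝔸 →ₗ[ℂ] ℂ) (prodCfg U η A)
        = action T η d (τ : 𝔸 →ₗ[ℂ] ℂ) U + φ A + q A := by
  obtain ⟨φ, hφ⟩ := exists_clm_bondPair τ η d (J T U η)
  refine ⟨φ, fun A => (2 : ℂ)⁻¹ * hessPair T U η d (τ : 𝔸 →ₗ[ℂ] ℂ) A + V0 T U η d (τ : 𝔸 →ₗ[ℂ] ℂ) A, hφ,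
    ?_, fun A => ?_⟩
  · have h2 := ((hasFDerivAt_hessPair_zero T U τ hτ η d).const_mul (2 : ℂ)⁻¹).add
      (hasFDerivAt_V0_zero T U τ hτ η hη hd)
    exact h2.congr_fderiv (by simp)
  · rw [eq26 T U η d (τ : 𝔸 →ₗ[ℂ] ℂ) A, hφ A]
    ring

/-- **(26) IN THE REAL FIRST-ORDER FORM USED ON p. 260 OF [Balaban1985UV3]**: for any map `D̃` of the bond-field space
with `D̃(0) = 0` and `D̃′(0) = 0` (there: the solution (17) «beginning with second order terms»), the REAL function
`f(A) = Re A(exp iη(A − D̃A)·U₀)` satisfies, for all `A`, `f(A) = f(0) + φ_ℝ(A − D̃A) + q(A)` with `φ_ℝ = Re⟨·, J⟩` a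
continuous `ℝ`-linear functional and `HasFDerivAt q 0 0` — the hypotheses `h26` (for all `A`, a fortiori eventually),
`hq` of `B10Eq19LinearTerm.inner_J_eq_zero_of_expansion26` (with its `hDt` = the present `hDt`).
[cite: Balaban1985Variational, (26)-(27) p.282] [cite: Balaban1985UV3, p.260 (before (19))] -/
theorem expansion26_real (τ : 𝔸 →L[ℂ] ℂ) (hτ : ∀ a b : 𝔸, τ (a * b) = τ (b * a)) (η : ℝ) (hη : η ≠ 0) {d : ℕ}
    (hd : 4 ≤ d) {Dt : (ι → S → 𝔸) → (ι → S → 𝔸)} (hDt0 : Dt 0 = 0)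
    (hDt : HasFDerivAt Dt (0 : (ι → S → 𝔸) →L[ℝ] (ι → S → 𝔸)) 0) :
    ∃ (φ : (ι → S → 𝔸) →L[ℝ] ℝ) (q : (ι → S → 𝔸) → ℝ),
      (∀ v, φ v = (bondPair η d (τ : 𝔸 →ₗ[ℂ] ℂ) v (J T U η)).re) ∧ HasFDerivAt q (0 : (ι → S → 𝔸) →L[ℝ] ℝ) 0 ∧
      ∀ A, (action T η d (τ : 𝔸 →ₗ[ℂ] ℂ) (prodCfg U η (A - Dt A))).re
        = (action T η d (τ : 𝔸 →ₗ[ℂ] ℂ) (prodCfg U η (0 - Dt 0))).re + φ (A - Dt A) + q A := by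
  obtain ⟨φ, q, hφ, hq, h26⟩ := expansion26 T U τ hτ η hη hd
  refine ⟨Complex.reCLM.comp (φ.restrictScalars ℝ), fun A => (q (A - Dt A)).re, fun v => by simp [hφ v], ?_,
    fun A => ?_⟩
  · -- chain rule: `A ↦ A − D̃A` has derivative `id` at `0` and value `0`; `q` has derivative `0` at `0`; then `Re`.
    have hh : HasFDerivAt (fun A : ι → S → 𝔸 => A - Dt A)
        ((ContinuousLinearMap.id ℝ (ι → S → 𝔸)) - 0) 0 := (hasFDerivAt_id (𝕜 := ℝ) (0 : ι → S → 𝔸)).sub hDt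
    have hh0 : (fun A : ι → S → 𝔸 => A - Dt A) 0 = 0 := by simp [hDt0]
    have hqR : HasFDerivAt q ((0 : (ι → S → 𝔸) →L[ℂ] ℂ).restrictScalars ℝ) ((fun A : ι → S → 𝔸 => A - Dt A) 0) := by
      rw [hh0]; exact hq.restrictScalars ℝ
    have hcomp := (Complex.reCLM.hasFDerivAt.comp _ (hqR.comp (0 : ι → S → 𝔸) hh))
    have hfeq : (fun A : ι → S → 𝔸 => (q (A - Dt A)).re)
        = (⇑Complex.reCLM ∘ q ∘ fun A : ι → S → 𝔸 => A - Dt A) := by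
      funext A; simp
    rw [hfeq]
    exact hcomp.congr_fderiv (by ext v; simp)
  · rw [h26 (A - Dt A), hDt0, sub_zero, B9Eq369Product.prodCfg_zero]
    simp

end FirstVariation

/-! ## §6 (27)–(28) «from hermiticity»: `⟨A, J⟩` is real, so `Re⟨A, J⟩ = 0 ⟹ ⟨A, J⟩ = 0` -/

section Hermitian

variable {𝔸 : Type*} [NormedRing 𝔸] [NormedAlgebra ℂ 𝔸] [StarRing 𝔸] [StarModule ℂ 𝔸]
variable {S : Type*} [Fintype S] {ι : Type*} [Fintype ι] [LinearOrder ι]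
variable (T : ι → Equiv.Perm S) (U : ι → S → 𝔸ˣ)

/-- **«FROM HERMITICITY OF DA»**: on the unitary group (`U₀(b)⁻¹ = U₀(b)*`), for a HERMITIAN bond field `A` and a
tracial `*`-compatible `τ`, the pairing `⟨A, J⟩` is REAL — it equals the printed `Σ_p η^{d−2} Im tr(DA)(p)U₀(∂p)` of
(26)/(27) (`B11Eq27Current.eq27`). [cite: Balaban1985Variational, (27)-(28) p.282] -/
theorem bondPair_J_im_eq_zero (hU : ∀ μ x, (((U μ x)⁻¹ : 𝔸ˣ) : 𝔸) = star (U μ x : 𝔸)) (τ : 𝔸 →ₗ[ℂ] ℂ)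
    (hτ : ∀ a b : 𝔸, τ (a * b) = τ (b * a)) (hτs : ∀ a : 𝔸, τ (star a) = starRingEnd ℂ (τ a)) (η : ℝ) (d : ℕ)
    {A : ι → S → 𝔸} (hA : ∀ μ x, star (A μ x) = A μ x) :
    (bondPair η d τ A (J T U η)).im = 0 := by
  obtain ⟨h1, h2⟩ := B11Eq27Current.eq27 T U hU τ hτ hτs η d hA
  rw [← h2, ← h1]
  have hreal : ((η : ℂ) ^ d * ∑ q ∈ posPlaq S ι, ((η : ℂ)⁻¹) ^ 2 *
      (((τ (curlη T U η A q.2.1 q.2.2 q.1 * (plaqU T U q.2.1 q.2.2 q.1 : 𝔸))).im : ℝ) : ℂ))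
      = ((η ^ d * ∑ q ∈ posPlaq S ι, (η⁻¹) ^ 2 *
          (τ (curlη T U η A q.2.1 q.2.2 q.1 * (plaqU T U q.2.1 q.2.2 q.1 : 𝔸))).im : ℝ) : ℂ) := by
    push_cast
    rfl
  rw [hreal, Complex.ofReal_im]

/-- Hence **`Re⟨A, J⟩ = 0 ⟹ ⟨A, J⟩ = 0`** for Hermitian `A` on the unitary group — the translation of the real Fermat
conclusion «φ_ℝ(v) = 0 on the constraint space» (`B10Eq19LinearTerm.inner_J_eq_zero_of_expansion26` fed with
`expansion26_real`) into «⟨v, J⟩ = 0», the (19) form of [Balaban1985UV3] p. 261.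
[cite: Balaban1985Variational, (27)-(28) p.282] [cite: Balaban1985UV3, p.260 (before (19))] -/
theorem bondPair_J_eq_zero_of_re (hU : ∀ μ x, (((U μ x)⁻¹ : 𝔸ˣ) : 𝔸) = star (U μ x : 𝔸)) (τ : 𝔸 →ₗ[ℂ] ℂ)
    (hτ : ∀ a b : 𝔸, τ (a * b) = τ (b * a)) (hτs : ∀ a : 𝔸, τ (star a) = starRingEnd ℂ (τ a)) (η : ℝ) (d : ℕ)
    {A : ι → S → 𝔸} (hA : ∀ μ x, star (A μ x) = A μ x) (hre : (bondPair η d τ A (J T U η)).re = 0) :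
    bondPair η d τ A (J T U η) = 0 :=
  Complex.ext hre (by rw [bondPair_J_im_eq_zero T U hU τ hτ hτs η d hA, Complex.zero_im])

/-- The same on a real CONSTRAINT SUBSPACE of Hermitian fields (print: `ker Q ∩ {axial gauge}`): if `Re⟨v, J⟩ = 0`
for all `v ∈ S` then `⟨v, J⟩ = 0` for all `v ∈ S` — «J ⟂ S», so that on `S` the expansion keeps only `−⟨D̃(A), J⟩`
as in (19) of [Balaban1985UV3]. [cite: Balaban1985Variational, (27)-(28) p.282] [cite: Balaban1985UV3, (19) p.261] -/
theorem bondPair_J_eq_zero_on (hU : ∀ μ x, (((U μ x)⁻¹ : 𝔸ˣ) : 𝔸) = star (U μ x : 𝔸)) (τ : 𝔸 →ₗ[ℂ] ℂ)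
    (hτ : ∀ a b : 𝔸, τ (a * b) = τ (b * a)) (hτs : ∀ a : 𝔸, τ (star a) = starRingEnd ℂ (τ a)) (η : ℝ) (d : ℕ)
    (Sc : Submodule ℝ (ι → S → 𝔸)) (hS : ∀ v ∈ Sc, ∀ μ x, star (v μ x) = v μ x)
    (hre : ∀ v ∈ Sc, (bondPair η d τ v (J T U η)).re = 0) :
    ∀ v ∈ Sc, bondPair η d τ v (J T U η) = 0 :=
  fun v hv => bondPair_J_eq_zero_of_re T U hU τ hτ hτs η d (hS v hv) (hre v hv)

end Hermitian

end Literature.MathematicalPhysics.QuantumFieldTheory.Balaban1983to89.B11Eq26FirstVariation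

end
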